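import Mathlib
import HarnessLib
import Summits.ResolutionOfSingularities.ResolutionOfSingularities.Theorems.WildQuotientsWildQuotientResolutionS1aGameFrame

/-!
# S1a — H4e-WF: the termination residue with a measure in ANY well-founded order, and the `KillTameModel` ASSEMBLY from it
[OURS · L1 W4.5c · tri-1 g5 (lens CYCLING); typed form of record for residue A5d per plan-1 RULING 2026-08-27T22:02:37Z]

NOT a statement of the manuscript; counted 0. AI-level work, weaker than expert review.

H4e's `Strategy` asks for `μ : GModel → ℕ`. Termination invariants in resolution are lexicographic vectors of BOUNDED
length (`Lex (Fin k → ℕ)`, `ℕ ×ₗ ℕ ×ₗ …`) — well-founded, but ℕ-valued only after a rank conversion. `StrategyWF` lets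
the producer hand over such an invariant directly; the assembly goes through by well-founded induction verbatim.

* `StrategyWF p q G ρ g₀` — some `μ : GModel → α`, `α` any type with a well-founded `<`, strictly decreasing along SOME
  admissible move from every non-terminal model;
* `strategyWF_of_strategy : Strategy → StrategyWF` (the case `α = ℕ`; nothing landed changes);
* **`killTameModel_of_wf` / `killTameModel_of_blowupNodeAtlas_wf : (∀ g, g ∈ zpowers g₀) → BlowupNodeAtlas p →
  EndGluing → StrategyWF p q G ρ g₀ → GModel p q G ρ g₀ → KillTameModel q G ρ`** — idea-2's proof of
  `killTameModel_of` with `WellFoundedLT.induction` in place of `Nat.strong_induction_on`.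

Warning of record (tree `Rescue/Negative/LabelLexNotWF.lean`): `Lex (ℕ →₀ ℕ)` — unbounded length — is NOT
well-founded; intended `α = Lex (Fin k → ℕ)` for a FIXED `k`.
-/

set_option linter.dupNamespace false

noncomputable section

open CategoryTheory AlgebraicGeometry TopologicalSpace
open Literature.AlgebraicGeometry.Resolution Literature.AlgebraicGeometry.RelativeSpec
open Summit.ResolutionOfSingularities.ResolutionOfSingularities.Theorems.WildQuotientResolution.S1
open Summit.ResolutionOfSingularities.ResolutionOfSingularities.Theorems.WildQuotientResolution.S1.NodeAtlas
open Summit.ResolutionOfSingularities.ResolutionOfSingularities.Theorems.WildQuotientResolution.S1.MoveStep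
open Summit.ResolutionOfSingularities.ResolutionOfSingularities.Theorems.WildQuotientResolution.S1.CentreNeBot

namespace Summit.ResolutionOfSingularities.ResolutionOfSingularities.Theorems.WildQuotientResolution.S1.GameFrame

variable (p : ℕ) {X' X₁ : Scheme.{0}} (q : X' ⟶ X₁) (G : Type) [Group G] (ρ : G →* Aut X') (g₀ : G)

/-- **(G6-WF) STRATEGY with a well-founded measure**: some `μ : GModel → α`, `α` any type with a well-founded `<`,
strictly decreasing along SOME admissible move from every non-terminal model. [OURS · L1 W4.5c · tri-1] — NOT a
statement of the manuscript. -/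
def StrategyWF : Prop :=
  ∃ (α : Type) (_ : LT α) (_ : WellFoundedLT α) (μ : GModel p q G ρ g₀ → α),
    ∀ M : GModel p q G ρ g₀, ¬ M.Terminal →
      ∃ (𝒦 : ReesFiltration M.V) (d : ℕ), IsAdmissibleCentre p M.act g₀ 𝒦 d ∧
        ∀ M' : GModel p q G ρ g₀, M.IsMoveOf M' 𝒦 d → μ M' < μ M

variable {p q G ρ g₀}

/-- The ℕ-valued `Strategy` of H4e is the special case `α = ℕ`. -/
theorem strategyWF_of_strategy (h : Strategy p q G ρ g₀) : StrategyWF p q G ρ g₀ := by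
  obtain ⟨μ, hμ⟩ := h
  exact ⟨ℕ, inferInstance, inferInstance, μ, hμ⟩

/-- **The `KillTameModel` ASSEMBLY from a well-founded strategy** — the proof of `killTameModel_of`, with
well-founded induction on `μ M` in place of strong induction on ℕ. -/
theorem killTameModel_of_wf [Finite G] [X₁.IsSeparated] [IsSeparated q] (hG : ∀ g : G, g ∈ Subgroup.zpowers g₀)
    (hmove : MoveStep.{0} p) (hend : EndGluing)
    (hstrat : StrategyWF p q G ρ g₀) (M₀ : GModel p q G ρ g₀) : KillTameModel q G ρ := by
  obtain ⟨α, _, hwf, μ, hμ⟩ := hstrat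
  suffices h : ∀ a : α, ∀ M : GModel p q G ρ g₀, μ M = a → KillTameModel q G ρ from h (μ M₀) M₀ rfl
  intro a
  induction a using hwf.induction with
  | _ a ih =>
    intro M ha
    by_cases hT : M.Terminal
    · exact killTameModel_of_terminal hend M hT
    · obtain ⟨𝒦, d, h𝒦, hdec⟩ := hμ M hT
      obtain ⟨M', hM'⟩ := exists_isMoveOf hmove hG M h𝒦
      exact ih (μ M') (ha ▸ hdec M' hM') M' rfl

/-- … and from the chart residue (G1), as in `killTameModel_of_blowupNodeAtlas`. -/
theorem killTameModel_of_blowupNodeAtlas_wf [Finite G] [X₁.IsSeparated] [IsSeparated q]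
    (hG : ∀ g : G, g ∈ Subgroup.zpowers g₀)
    (hcharts : BlowupNodeAtlas.{0} p) (hend : EndGluing) (hstrat : StrategyWF p q G ρ g₀)
    (M₀ : GModel p q G ρ g₀) : KillTameModel q G ρ :=
  killTameModel_of_wf hG (moveStep_of_blowupNodeAtlas hcharts) hend hstrat M₀

/-- Bounded-length lexicographic invariants are admissible measures (Mathlib instance). -/
example : WellFoundedLT (ℕ ×ₗ ℕ) := inferInstance

/-- Bounded-length lexicographic invariants are admissible measures (Mathlib instance). -/
example (k : ℕ) : WellFoundedLT (Lex (Fin k → ℕ)) := inferInstance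

end Summit.ResolutionOfSingularities.ResolutionOfSingularities.Theorems.WildQuotientResolution.S1.GameFrame

end
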